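import Mathlib
import Summits.ValiantsHypothesis.ValiantsHypothesis.Theorems.BarrierLeverPartitionMinorsHitByVPHiddenStatesGreedyCut
import Summits.ValiantsHypothesis.ValiantsHypothesis.Theorems.BarrierLeverPartitionMinorsHitByVPHiddenStatesPairBlock

/-!
# Route BarrierLever — item `PartitionMinorsHitByVP` (stmt-ValiantsHypothesis-19717), line `hidden_states`:
# THE MATCHING THEOREM, part 1/2 — plumbing: splitting equivalences, bases vs. blocks, non-sunflower triples

Helper file (`--supports stmt-ValiantsHypothesis-19717`; cell valiant-natproofs, rung V4, 𝒟-side door (c); prover seat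
val-np-p3 gen 20). Definition-free. Closes NO item. Memo HOME/val-np-p3/g20/MEMO-blockpeeling-valnp3-g20.md §4–§5.

* `exists_splitEquiv` / `mem_iff_of_splitEquiv` — enumerating a finset of `Fin r` and its complement gives the block
  equivalence `Fin n ⊕ Fin n' ≃ Fin r` used by `GreedyCut.det_blockZero_ne_zero`.
* `det_ne_zero_of_isBase` — a base of the row matroid of a column block (`GreedyCut.IsBase`) has a nonsingular square block
  in every enumeration (converse of `GreedyCut.isBase_of_det_ne_zero`).
* **`exists_not_sunflower3`** — an injective family of MORE THAN `h` subsets of `Fin h` (and at least three) contains three members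
  that are not a singleton-petal sunflower (`PairBlock.Sunflower3`): otherwise all members are `C + one element` for a common
  core `C`, an injection into `Fin h`. With the triple lemma (`PairBlock.exists_table_triple`) this says: the pair block has rank 3
  on every family of more than `h` monomials — the peeling step of part 2.

WHAT THIS IS NOT: no design is proved good here; item 19717 stays OPEN; nothing on crux 14610 or VP ≠ VNP.
-/

set_option linter.dupNamespace false

namespace Summit.ValiantsHypothesis.ValiantsHypothesis.Theorems.BarrierLever.HiddenStates

open Finset Matrix

noncomputable section

namespace Matching

open PairBlock GreedyCut

variable {h K r : ℕ}

/-! ## 1. Plumbing: splitting equivalences, bases vs. nonsingular blocks -/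

/-- Three pairwise distinct values give an injective `![a, b, c]`. -/
theorem injective_vec3 {α : Type*} (a b c : α) (hab : a ≠ b) (hac : a ≠ c) (hbc : b ≠ c) :
    Function.Injective (![a, b, c] : Fin 3 → α) := by
  intro x x' hxx'
  fin_cases x <;> fin_cases x' <;> simp_all

/-- Enumerating a finset and its complement gives an equivalence `Fin n ⊕ Fin n' ≃ Fin r`. -/
theorem exists_splitEquiv (R : Finset (Fin r)) {n n' : ℕ} (hn : R.card = n) (hn' : Rᶜ.card = n') :
    ∃ e : Fin n ⊕ Fin n' ≃ Fin r, (∀ x, e (Sum.inl x) = R.orderEmbOfFin hn x) ∧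
      (∀ y, e (Sum.inr y) = Rᶜ.orderEmbOfFin hn' y) := by
  classical
  set f : Fin n ⊕ Fin n' → Fin r := Sum.elim (fun x => R.orderEmbOfFin hn x) (fun y => Rᶜ.orderEmbOfFin hn' y)
    with hf
  have hinj : Function.Injective f := by
    rintro (x | y) (x' | y') hxy
    · simp only [hf, Sum.elim_inl] at hxy
      rw [(R.orderEmbOfFin hn).injective hxy]
    · simp only [hf, Sum.elim_inl, Sum.elim_inr] at hxy
      have h1 := R.orderEmbOfFin_mem hn x
      have h2 := Finset.mem_compl.mp (Rᶜ.orderEmbOfFin_mem hn' y')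
      rw [hxy] at h1
      exact absurd h1 h2
    · simp only [hf, Sum.elim_inl, Sum.elim_inr] at hxy
      have h1 := R.orderEmbOfFin_mem hn x'
      have h2 := Finset.mem_compl.mp (Rᶜ.orderEmbOfFin_mem hn' y)
      rw [← hxy] at h1
      exact absurd h1 h2
    · simp only [hf, Sum.elim_inr] at hxy
      rw [(Rᶜ.orderEmbOfFin hn').injective hxy]
  have hcard : Fintype.card (Fin n ⊕ Fin n') = Fintype.card (Fin r) := by
    rw [Fintype.card_sum, Fintype.card_fin, Fintype.card_fin, Fintype.card_fin, ← hn, ← hn',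
      Finset.card_compl, Fintype.card_fin]
    have h1 : R.card ≤ r := by simpa using R.card_le_univ
    omega
  have hbij : Function.Bijective f := (Fintype.bijective_iff_injective_and_card f).mpr ⟨hinj, hcard⟩
  exact ⟨Equiv.ofBijective f hbij, fun x => rfl, fun y => rfl⟩

/-- Membership in `R` along a splitting equivalence. -/
theorem mem_iff_of_splitEquiv (R : Finset (Fin r)) {n n' : ℕ} (hn : R.card = n) (hn' : Rᶜ.card = n')
    (e : Fin n ⊕ Fin n' ≃ Fin r) (hl : ∀ x, e (Sum.inl x) = R.orderEmbOfFin hn x)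
    (hr' : ∀ y, e (Sum.inr y) = Rᶜ.orderEmbOfFin hn' y) (i : Fin r) :
    i ∈ R ↔ ∃ x, e (Sum.inl x) = i := by
  constructor
  · intro hi
    obtain ⟨s, hs⟩ := e.surjective i
    rcases s with x | y
    · exact ⟨x, hs⟩
    · rw [hr'] at hs
      have := Finset.mem_compl.mp (Rᶜ.orderEmbOfFin_mem hn' y)
      rw [hs] at this
      exact absurd hi this
  · rintro ⟨x, rfl⟩
    rw [hl]
    exact R.orderEmbOfFin_mem hn x

/-- A base has a nonsingular square block in every enumeration (converse of `GreedyCut.isBase_of_det_ne_zero`). -/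
theorem det_ne_zero_of_isBase {n : ℕ} (N : Matrix (Fin r) (Fin r) ℂ) (P R : Finset (Fin r))
    (hB : IsBase N P R) (eR : Fin n ≃ R) (eP : Fin n ≃ P) :
    (Matrix.of fun x x' : Fin n => N (eR x) (eP x')).det ≠ 0 := by
  classical
  set A : Matrix (Fin n) (Fin n) ℂ := Matrix.of fun x x' : Fin n => N (eR x) (eP x') with hAdef
  -- transport the independence of the rows `R` (restricted to `P`) to the rows of `A`
  have hli : LinearIndependent ℂ (fun i : (R : Set (Fin r)) => rowVec N P i) := hB.2
  let e : Fin n ≃ (R : Set (Fin r)) := eR.trans (Equiv.subtypeEquivRight (fun x => by simp))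
  have key : (fun i : (R : Set (Fin r)) => rowVec N P i) ∘ e = fun x => rowVec N P (eR x) := by
    funext x; rfl
  have hcomp : LinearIndependent ℂ (fun x : Fin n => rowVec N P (eR x)) :=
    (linearIndependent_equiv' e key).mpr hli
  let L : (P → ℂ) →ₗ[ℂ] (Fin n → ℂ) := LinearMap.funLeft ℂ ℂ eP
  have hrows : (fun x : Fin n => A x) = L ∘ fun x : Fin n => rowVec N P (eR x) := by
    funext x x'
    simp [L, LinearMap.funLeft, rowVec, hAdef]
  have hLinj : Function.Injective L := LinearMap.funLeft_injective_of_surjective _ _ _ eP.surjective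
  have hliA : LinearIndependent ℂ (fun x : Fin n => A x) := by
    rw [hrows]
    exact hcomp.map' L (LinearMap.ker_eq_bot.mpr hLinj)
  have hunit : IsUnit A := Matrix.linearIndependent_rows_iff_isUnit.mp hliA
  exact ((Matrix.isUnit_iff_isUnit_det A).mp hunit).ne_zero

/-! ## 2. Families with more than `h` members contain a non-sunflower triple -/

/-- In an injective family of more than `h` (and at least three) subsets of `Fin h`, some three members are NOT a
singleton-petal sunflower. -/
theorem exists_not_sunflower3 (ℛ : Fin r → Finset (Fin h)) (hinj : Function.Injective ℛ) (h3 : 3 ≤ r) (hr : h < r) :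
    ∃ i j l : Fin r, i ≠ j ∧ i ≠ l ∧ j ≠ l ∧ ¬ Sunflower3 (ℛ i) (ℛ j) (ℛ l) := by
  classical
  set i₀ : Fin r := ⟨0, by omega⟩ with hi₀
  set i₁ : Fin r := ⟨1, by omega⟩ with hi₁
  set i₂ : Fin r := ⟨2, by omega⟩ with hi₂
  have d01 : i₀ ≠ i₁ := by simp [hi₀, hi₁, Fin.ext_iff]
  have d02 : i₀ ≠ i₂ := by simp [hi₀, hi₂, Fin.ext_iff]
  have d12 : i₁ ≠ i₂ := by simp [hi₁, hi₂, Fin.ext_iff]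
  by_contra hall
  push Not at hall
  -- every triple is a sunflower; in particular with `i₀, i₁` and any third index
  set C := ℛ i₀ ∩ ℛ i₁ with hC
  have hs01 := hall i₀ i₁ i₂ d01 d02 d12
  -- the common size
  have hsize : ∀ l, l ≠ i₀ → l ≠ i₁ → (ℛ l).card = (ℛ i₀).card ∧ C ⊆ ℛ l := by
    intro l hl0 hl1
    have hs := hall i₀ i₁ l d01 (Ne.symm hl0) (Ne.symm hl1)
    obtain ⟨h01, h1l, hcore⟩ := hs
    refine ⟨by rw [h01, h1l], ?_⟩
    -- `|C ∩ ℛ l| + 1 = |ℛ i₀|` and `|C| ≤ |ℛ i₀| - 1` force `C ⊆ ℛ l`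
    have hCle : C.card + 1 ≤ (ℛ i₀).card := by
      -- `C ⊊ ℛ i₀` since `ℛ i₀ ≠ ℛ i₁` have the same size
      have hne : ℛ i₀ ≠ ℛ i₁ := fun h => d01 (hinj h)
      have hClt : C.card < (ℛ i₀).card := by
        refine Finset.card_lt_card (Finset.ssubset_iff_subset_ne.mpr ⟨Finset.inter_subset_left, fun hEq => hne ?_⟩)
        have hsub : ℛ i₀ ⊆ ℛ i₁ := by rw [← hEq]; exact Finset.inter_subset_right
        exact Finset.eq_of_subset_of_card_le hsub (by rw [h01])
      omega
    have hsub : C ∩ ℛ l ⊆ C := Finset.inter_subset_left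
    have hcore' : (C ∩ ℛ l).card + 1 = (ℛ i₀).card := by rw [hC]; exact hcore
    have hcard : (C ∩ ℛ l).card = C.card := by
      have h1 := Finset.card_le_card hsub
      omega
    have hEq : C ∩ ℛ l = C := Finset.eq_of_subset_of_card_le hsub (by rw [hcard])
    rw [← hEq]
    exact Finset.inter_subset_right
  -- each `ℛ l` is `C` plus exactly one element (also for `l = i₀, i₁`)
  have hone : ∀ l, ((ℛ l) \ C).card = 1 := by
    intro l
    obtain ⟨h01, h12, hcore⟩ := hs01
    have hC0 : C ⊆ ℛ i₀ := Finset.inter_subset_left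
    have hC1 : C ⊆ ℛ i₁ := Finset.inter_subset_right
    have hCcard : C.card + 1 = (ℛ i₀).card := by
      -- from the triple `(i₀, i₁, i₂)`: `|C ∩ ℛ i₂| + 1 = |ℛ i₀|`, and `C ∩ ℛ i₂ = C`
      obtain ⟨-, hsub2⟩ := hsize i₂ d02.symm d12.symm
      have hcore' : (C ∩ ℛ i₂).card + 1 = (ℛ i₀).card := by rw [hC]; exact hcore
      rwa [Finset.inter_eq_left.mpr hsub2] at hcore'
    by_cases hl0 : l = i₀
    · subst hl0; rw [Finset.card_sdiff_of_subset hC0]; omega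
    by_cases hl1 : l = i₁
    · subst hl1; rw [Finset.card_sdiff_of_subset hC1]; omega
    obtain ⟨hcl, hCl⟩ := hsize l hl0 hl1
    rw [Finset.card_sdiff_of_subset hCl]; omega
  -- the petal map `l ↦ the element of ℛ l \ C` is an injection `Fin r → Fin h`
  have hpet : ∀ l, ∃ a : Fin h, ℛ l \ C = {a} := fun l => Finset.card_eq_one.mp (hone l)
  choose pet hpet' using hpet
  have hCsub : ∀ l, C ⊆ ℛ l := by
    intro l
    by_cases hl0 : l = i₀
    · subst hl0; exact Finset.inter_subset_left
    by_cases hl1 : l = i₁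
    · subst hl1; exact Finset.inter_subset_right
    exact (hsize l hl0 hl1).2
  have hpinj : Function.Injective pet := by
    intro l l' hll'
    apply hinj
    have hl : ℛ l = C ∪ {pet l} := by
      rw [← hpet' l, Finset.union_sdiff_of_subset (hCsub l)]
    have hl' : ℛ l' = C ∪ {pet l'} := by
      rw [← hpet' l', Finset.union_sdiff_of_subset (hCsub l')]
    rw [hl, hl', hll']
  have := Fintype.card_le_of_injective pet hpinj
  simp only [Fintype.card_fin] at this
  omega

end Matching

end

end Summit.ValiantsHypothesis.ValiantsHypothesis.Theorems.BarrierLever.HiddenStates
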